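import Summits.QuantumFields.BalabanUV.T4Continuum.Support.ShellMeasureWilsonLedgerSource

/-!
# `T4Continuum.ShellMeasureWilsonLedgerFamily` — row S19 file 3: the level-0 ledger over a CUTOFF-INDEXED FAMILY OF
# LATTICES `P K` with cutoff-dependent couplings `β K`, windows `S K`, thresholds and sources — END-I's literal
# `Ω : ℕ → σ → Type*` generality — and the UNIFORMITY-IN-THE-CUTOFF of the level-0 constant DISPLAYED as one binder
# (cell `pub-balaban`, sub-cell `t4`, spine estimate NE7c (node U5b); NE7c ROUND-2 crew `t4-ne7c-formalise-*`, unit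
# `b2b-balaban-t4-ne7c-formalise-leaf-06`, row S19 (owner RECUT, journal l.6666) file 3; ADDITIVE — imports row S19
# file 2 `ShellMeasureWilsonLedgerSource` (p209573) only; 0 `def`, 0 sorry, 0 cite tags)

HONEST FRAMING.  Finite four-torus programme, rung (B)+1 only — NOT infinite volume, NOT a mass gap, NOT the Clay
problem, NOT summit progress.  NE7c = `T4IndicatorShell.ShellWeightBound` is NOT PRINTED in [Balaban 1983–89] and NOT
PROVED; «NE7c ⇐ the named binders» (trigger c3); a ONE-run level-0 ledger is NOT NE7c.  Files 1–2 of the row worked on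
ONE lattice; END-I (`ShellMeasureRootComposition.levelLedger_of_slotAC`) is stated for configuration spaces
`Ω K s` depending on the cutoff `K` — in the cell's two-run comparison the run at cutoff `K` lives on its own lattice
`P K` with its own bare coupling `β K`.  This file is that bookkeeping, pointwise in `K` the proof of file 2, with ONE
consequence made visible: END-I wants ONE level constant `D 0` for all cutoffs, while row S1's (M1)₀ constant at cutoff
`K` is `2(n_{K,s} + β_K·#P_w·8S_K(8+32S_K))/(1−δ)·e^{2 l₀ w}` — so the UNIFORMITY IN `K` of that expression is a
DISPLAYED binder (`hD`), the level-0 face of the skeleton's «SM-L10: D_j ≤ D̄ absorbed»: it couples the chart window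
`S_K` to the coupling `β_K` (bounded `β_K·S_K`), which is for the instantiator to meet (print's windows ARE
coupling-scaled — a READING, not used here).  Nothing printed is asserted; [folklore] composition BY NAME.  HONEST
DEPENDENCY (cell): continuum YM on T⁴ ⇐ BetaPertH ∧ nine spine estimates (0/9 proved); BetaPertH ⇐ (D1) ∧ (D4) ∧
CAP+tail; G-an2-4 gates asym, D1 and NE2/3/4.

## What is proved ([folklore])

`levelLedger_wilson_su2_levelZero_family` — for lattices `P K` (levels `jl K`), cubes `C K ⊆ σ₀` with per-(K, s)
box data (row S1's geometry), per-K numerics `β K, S K, σc K` with the common `θ 0, ρ 0, δ`, bounded sources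
`Fobs K` (`|Fobs K| ≤ w`), the realized measure of every slot at `(K, t)` the tilted Gibbs law
`μ K t = e^{t·Fobs K} e^{−β_K Σ_{P_all K}} dU` on `GaugeField (P K) (jl K) SU2`, tested variables
`wilsonU (P_u K s)`; (M1)₀ discharged per `(K, s)` by file 2's `slotAntiConcentration_wilson_su2_gibbs_source`;
DISPLAYED: the other run's measurable variables `u^B K t s` on the same spaces, the per-cube a.e. closeness, the
numerics per `K`, and the UNIFORM constant `hD : ∀ K s, D_{K,s} ≤ D 0`.  Conclusion: `T4ShellMeasureLevels.LevelLedger`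
for row S17's cube-partition families, literally in END-I's `K`-indexed shape.

WHAT THIS DOES NOT DO.  No window/count ((W1), row S9), no rate (node U1b), no live level, no second run from its own
measures (same theorem, roles exchanged), no verification that print's coupling-scaled windows meet `hD`; NE7c NOT
proved; 0/9 spine.
-/

noncomputable section

open Set Function MeasureTheory Finset

namespace Summit.QuantumFields.BalabanUV.T4Continuum.ShellMeasureWilsonLedgerFamily

open scoped ENNReal
open Literature.MathematicalPhysics.QuantumFieldTheory.Balaban1983to89
open T4ShellMeasure (SlotAntiConcentration)
open T4ShellMeasureLevels (LevelLedger)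
open T4CubeChartGnomonic (SU2)
open T4AxialGaugeFixing (combBonds)
open T4AxialGaugeSmallField (boxPlaqs boxBonds)
open ShellMeasureWilsonRealizedSU2 (wilsonU measurable_wilsonU wilsonSum_nonneg)
open ShellMeasureRootCompositionPushCubes (regionWeight regionShell regionPiece levelLedger_levelZero_cubes)
open ShellMeasureWilsonLedgerSource (slotAntiConcentration_wilson_su2_gibbs_source)

variable (P : ℕ → Params) (jl : ℕ → ℕ) [∀ K, DecidableEq (PBond (P K) (jl K))] [∀ K, DecidableEq (Plaq (P K) (jl K))]
  {σ₀ : Type*} [DecidableEq σ₀]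

/-- **THE LEVEL-0 ONE-RUN LEDGER OVER THE CUTOFF-INDEXED LATTICE FAMILY.**  At cutoff `K` the run lives on the lattice
`P K` (level `jl K`) with bare coupling `β K`, chart window `S K`, co-test threshold `σc K` and a bounded source
`Fobs K`; every slot `s ∈ C K` carries row S1's box data on that lattice; the realized measure of every slot at `(K, t)`
is the tilted Gibbs law of cutoff `K`.  HYPOTHESES displayed: geometry/numerics per `K` (row S1's, with `θ 0 ≤ σc K`),
`|Fobs K| ≤ w`, the other run's measurable tested variables and the per-cube a.e. closeness `|wilsonU − u^B| ≤ ρ₀θ₀`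
(node U1b at level 0), signs, and the UNIFORMITY `hD : ∀ K s, 2(n_{K,s} + β_K·#P_w·8S_K(8+32S_K))/(1−δ)·e^{2l₀w} ≤ D 0`
(SM-L10 at level 0).  CONCLUSION: END-I's one-run `LevelLedger` in its literal `K`-indexed shape, (M1)₀ discharged.
NOT NE7c; nothing printed asserted. [folklore] -/
theorem levelLedger_wilson_su2_levelZero_family
    (lo hi : ∀ K, σ₀ → Fin (P K).d → ℤ) (m : ℕ → σ₀ → ℕ)
    (hN : ∀ K s κ, hi K s κ - lo K s κ < (P K).sitesPerDir (jl K)) (hm : ∀ K s κ, hi K s κ ≤ lo K s κ + m K s)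
    (Λ : ∀ K, σ₀ → Finset (PBond (P K) (jl K))) (hΛbox : ∀ K s, ∀ b ∈ Λ K s, b ∈ boxBonds (lo K s) (hi K s))
    (hΛcomb : ∀ K s, Disjoint (Λ K s) (combBonds (lo K s) (hi K s)))
    (hcov : ∀ K s, ∀ b ∈ boxBonds (lo K s) (hi K s), b ∉ Λ K s →
      b ∈ (combBonds (lo K s) (hi K s) : Finset (PBond (P K) (jl K))))
    (n : ℕ → σ₀ → ℕ) (e : ∀ K s, ↥(Λ K s) × Fin 3 ≃ Fin (n K s))
    (S σc : ℕ → ℝ) (hS : ∀ K, 0 < S K) (hS8 : ∀ K, S K ≤ 1 / 8) (hSπ : ∀ K, 3 * S K ^ 2 < Real.pi ^ 2)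
    (hσ : ∀ K, 0 < σc K) (hrad : ∀ K s, (((P K).d - 1 : ℕ) : ℝ) * m K s * σc K ≤ 2 * S K / Real.pi)
    (Pu : ∀ K, σ₀ → Finset (Plaq (P K) (jl K))) (hPu : ∀ K s, (Pu K s).Nonempty)
    (hPubox : ∀ K s, ∀ p ∈ Pu K s, p ∈ boxPlaqs (lo K s) (hi K s))
    (hboxPu : ∀ K s, boxPlaqs (lo K s) (hi K s) ⊆ (↑(Pu K s) : Set (Plaq (P K) (jl K))))
    (Pw Pext : ∀ K, σ₀ → Finset (Plaq (P K) (jl K))) (Pall : ∀ K, Finset (Plaq (P K) (jl K)))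
    (β : ℕ → ℝ) {δ : ℝ} {θ ρ D : ℕ → ℝ} (hβ : ∀ K, 0 ≤ β K) (hθ : 0 < θ 0) (hθσ : ∀ K, θ 0 ≤ σc K) (hδ0 : 0 ≤ δ)
    (hδ1 : δ < 1) (hρ0 : ∀ i, 0 ≤ ρ i) (hρ : ρ 0 ≤ (1 - δ) / 2)
    (hSM : ∀ K, 4 * (8 * S K) ^ 2 * Real.exp (2 * (8 * S K)) ≤ δ * θ 0)
    (hSMσ : ∀ K, 4 * (8 * S K) ^ 2 * Real.exp (2 * (8 * S K)) ≤ δ * σc K)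
    (hPext : ∀ K s, ∀ p ∈ Pext K s, (⟨p.src, p.μ⟩ : PBond (P K) (jl K)) ∉ Λ K s ∧
      (⟨p.src.shift p.μ, p.ν⟩ : PBond (P K) (jl K)) ∉ Λ K s ∧ (⟨p.src.shift p.ν, p.μ⟩ : PBond (P K) (jl K)) ∉ Λ K s ∧
      (⟨p.src, p.ν⟩ : PBond (P K) (jl K)) ∉ Λ K s)
    (hdisj : ∀ K s, Disjoint (Pext K s) (Pw K s)) (hall : ∀ K s, Pext K s ∪ Pw K s = Pall K)
    (Fobs : ∀ K, GaugeField (P K) (jl K) SU2 → ℝ) {w l₀ : ℝ} (hw : 0 ≤ w) (hFw : ∀ K U, |Fobs K U| ≤ w)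
    (hD0 : ∀ i, 0 ≤ D i)
    (hD : ∀ K s, 2 * ((n K s : ℝ) + β K * ∑ _p ∈ Pw K s, (8 * S K) * (8 + 4 * (8 * S K))) / (1 - δ) *
      Real.exp (2 * l₀ * w) ≤ D 0)
    (C : ℕ → Finset σ₀) (uB : ∀ K : ℕ, ℝ → σ₀ → GaugeField (P K) (jl K) SU2 → ℝ)
    (huB : ∀ K t s, Measurable (uB K t s))
    (hclose : ∀ K t, |t| ≤ l₀ → ∀ s ∈ C K,
      ∀ᵐ U ∂((fieldMeasure (P K) (jl K) SU2).withDensity fun U => ENNReal.ofReal (Real.exp (t * Fobs K U)) *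
        ENNReal.ofReal (Real.exp (-(β K * ∑ p ∈ Pall K, (1 - reTr (GaugeField.plaqHol U p)))))),
        |wilsonU (hPu K s) U - uB K t s U| ≤ ρ 0 * θ 0) :
    LevelLedger l₀ (fun K => (C K).powerset)
      (fun K t => regionWeight (C K)
        ((fieldMeasure (P K) (jl K) SU2).withDensity fun U => ENNReal.ofReal (Real.exp (t * Fobs K U)) *
          ENNReal.ofReal (Real.exp (-(β K * ∑ p ∈ Pall K, (1 - reTr (GaugeField.plaqHol U p))))))
        (fun s => wilsonU (hPu K s)) (θ 0))
      (fun K t => regionShell (C K)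
        ((fieldMeasure (P K) (jl K) SU2).withDensity fun U => ENNReal.ofReal (Real.exp (t * Fobs K U)) *
          ENNReal.ofReal (Real.exp (-(β K * ∑ p ∈ Pall K, (1 - reTr (GaugeField.plaqHol U p))))))
        (fun s => wilsonU (hPu K s)) (uB K t) (θ 0))
      C
      (fun K t => regionPiece (C K)
        ((fieldMeasure (P K) (jl K) SU2).withDensity fun U => ENNReal.ofReal (Real.exp (t * Fobs K U)) *
          ENNReal.ofReal (Real.exp (-(β K * ∑ p ∈ Pall K, (1 - reTr (GaugeField.plaqHol U p))))))
        (fun s => wilsonU (hPu K s)) (uB K t) (θ 0))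
      (fun _ _ => 0) D ρ := by
  -- every tilted Gibbs law is a finite measure
  haveI : ∀ (K : ℕ) (t : ℝ), IsFiniteMeasure ((fieldMeasure (P K) (jl K) SU2).withDensity fun U =>
      ENNReal.ofReal (Real.exp (t * Fobs K U)) *
        ENNReal.ofReal (Real.exp (-(β K * ∑ p ∈ Pall K, (1 - reTr (GaugeField.plaqHol U p)))))) := fun K t => by
    refine isFiniteMeasure_withDensity (ne_top_of_le_ne_top ?_ (lintegral_mono (g := fun _ =>
      ENNReal.ofReal (Real.exp (|t| * w))) fun U => ?_))
    · rw [lintegral_const]; exact ENNReal.mul_ne_top ENNReal.ofReal_ne_top (measure_ne_top _ _)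
    · calc ENNReal.ofReal (Real.exp (t * Fobs K U)) *
            ENNReal.ofReal (Real.exp (-(β K * ∑ p ∈ Pall K, (1 - reTr (GaugeField.plaqHol U p)))))
          ≤ ENNReal.ofReal (Real.exp (|t| * w)) * 1 := by
            refine mul_le_mul' (ENNReal.ofReal_le_ofReal (Real.exp_le_exp.2 ?_)) ?_
            · calc t * Fobs K U ≤ |t * Fobs K U| := le_abs_self _
                _ = |t| * |Fobs K U| := abs_mul _ _
                _ ≤ |t| * w := mul_le_mul_of_nonneg_left (hFw K U) (abs_nonneg t)
            · rw [ENNReal.ofReal_le_one, Real.exp_le_one_iff, neg_nonpos]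
              exact mul_nonneg (hβ K) (wilsonSum_nonneg (Pall K) U)
        _ = ENNReal.ofReal (Real.exp (|t| * w)) := mul_one _
  -- (M1)₀ per (K, slot) for `|t| ≤ l₀`, raised to the uniform constant `D 0`
  have hac : ∀ (K : ℕ) (t : ℝ), |t| ≤ l₀ → ∀ s ∈ C K, SlotAntiConcentration
      ((fieldMeasure (P K) (jl K) SU2).withDensity fun U => ENNReal.ofReal (Real.exp (t * Fobs K U)) *
        ENNReal.ofReal (Real.exp (-(β K * ∑ p ∈ Pall K, (1 - reTr (GaugeField.plaqHol U p))))))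
      (wilsonU (hPu K s)) (θ 0) (ρ 0) (D 0) := fun K t ht s _ =>
    T4ShellMeasureFibre.slotAntiConcentration_mono (hρ0 0) (hD K s)
      (slotAntiConcentration_wilson_su2_gibbs_source (hN K s) (hm K s) (Λ K s) (hΛbox K s) (hΛcomb K s) (hcov K s)
        (e K s) (hS K) (hS8 K) (hSπ K) (hσ K) (hrad K s) (hPu K s) (hPubox K s) (hboxPu K s) (Pw K s) (Pext K s)
        (Pall K) (hβ K) hθ (hθσ K) hδ0 hδ1 (hρ0 0) hρ (hSM K) (hSMσ K) (hPext K s) (hdisj K s) (hall K s) hw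
        (hFw K) ht)
  exact levelLedger_levelZero_cubes
    (μ := fun K t => (fieldMeasure (P K) (jl K) SU2).withDensity fun U => ENNReal.ofReal (Real.exp (t * Fobs K U)) *
      ENNReal.ofReal (Real.exp (-(β K * ∑ p ∈ Pall K, (1 - reTr (GaugeField.plaqHol U p))))))
    (uA := fun K _ s => wilsonU (hPu K s)) (fun K _ s => measurable_wilsonU (hPu K s)) huB hclose hD0 hρ0 hac

/-! ## v1.1 — the uniformity binder restricted to the LIVE slots -/

/-- **v1.1: `levelLedger_wilson_su2_levelZero_family` WITH THE UNIFORMITY BINDER ASKED ONLY ON THE SLOTS PRESENT AT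
EACH CUTOFF** (`hD : ∀ K, ∀ s ∈ C K, D_{K,s} ≤ D 0` instead of `∀ K s`).  END-I uses (M1)₀ only for `s ∈ C K`; in any
END-I instantiation the level-0 cubes are LIVE only while `K ≤ N₁` (`T4ShellMeasureLevels.LiveWindow.recent`), i.e.
`C K = ∅` for `K > N₁`, so the uniformity in the cutoff is owed on finitely many cutoffs only — v1's `∀ K s` form asked it
along the whole family, which the coupling-scaled windows cannot meet as `β_K → ∞` with `θ 0` fixed (level thresholds in
END-I are indexed by LEVEL, not by cutoff: a level-0 slot of cutoff `K > N₁` is never live).  Same proof; nothing else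
changed. [folklore] -/
theorem levelLedger_wilson_su2_levelZero_family'
    (lo hi : ∀ K, σ₀ → Fin (P K).d → ℤ) (m : ℕ → σ₀ → ℕ)
    (hN : ∀ K s κ, hi K s κ - lo K s κ < (P K).sitesPerDir (jl K)) (hm : ∀ K s κ, hi K s κ ≤ lo K s κ + m K s)
    (Λ : ∀ K, σ₀ → Finset (PBond (P K) (jl K))) (hΛbox : ∀ K s, ∀ b ∈ Λ K s, b ∈ boxBonds (lo K s) (hi K s))
    (hΛcomb : ∀ K s, Disjoint (Λ K s) (combBonds (lo K s) (hi K s)))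
    (hcov : ∀ K s, ∀ b ∈ boxBonds (lo K s) (hi K s), b ∉ Λ K s →
      b ∈ (combBonds (lo K s) (hi K s) : Finset (PBond (P K) (jl K))))
    (n : ℕ → σ₀ → ℕ) (e : ∀ K s, ↥(Λ K s) × Fin 3 ≃ Fin (n K s))
    (S σc : ℕ → ℝ) (hS : ∀ K, 0 < S K) (hS8 : ∀ K, S K ≤ 1 / 8) (hSπ : ∀ K, 3 * S K ^ 2 < Real.pi ^ 2)
    (hσ : ∀ K, 0 < σc K) (hrad : ∀ K s, (((P K).d - 1 : ℕ) : ℝ) * m K s * σc K ≤ 2 * S K / Real.pi)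
    (Pu : ∀ K, σ₀ → Finset (Plaq (P K) (jl K))) (hPu : ∀ K s, (Pu K s).Nonempty)
    (hPubox : ∀ K s, ∀ p ∈ Pu K s, p ∈ boxPlaqs (lo K s) (hi K s))
    (hboxPu : ∀ K s, boxPlaqs (lo K s) (hi K s) ⊆ (↑(Pu K s) : Set (Plaq (P K) (jl K))))
    (Pw Pext : ∀ K, σ₀ → Finset (Plaq (P K) (jl K))) (Pall : ∀ K, Finset (Plaq (P K) (jl K)))
    (β : ℕ → ℝ) {δ : ℝ} {θ ρ D : ℕ → ℝ} (hβ : ∀ K, 0 ≤ β K) (hθ : 0 < θ 0) (hθσ : ∀ K, θ 0 ≤ σc K) (hδ0 : 0 ≤ δ)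
    (hδ1 : δ < 1) (hρ0 : ∀ i, 0 ≤ ρ i) (hρ : ρ 0 ≤ (1 - δ) / 2)
    (hSM : ∀ K, 4 * (8 * S K) ^ 2 * Real.exp (2 * (8 * S K)) ≤ δ * θ 0)
    (hSMσ : ∀ K, 4 * (8 * S K) ^ 2 * Real.exp (2 * (8 * S K)) ≤ δ * σc K)
    (hPext : ∀ K s, ∀ p ∈ Pext K s, (⟨p.src, p.μ⟩ : PBond (P K) (jl K)) ∉ Λ K s ∧
      (⟨p.src.shift p.μ, p.ν⟩ : PBond (P K) (jl K)) ∉ Λ K s ∧ (⟨p.src.shift p.ν, p.μ⟩ : PBond (P K) (jl K)) ∉ Λ K s ∧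
      (⟨p.src, p.ν⟩ : PBond (P K) (jl K)) ∉ Λ K s)
    (hdisj : ∀ K s, Disjoint (Pext K s) (Pw K s)) (hall : ∀ K s, Pext K s ∪ Pw K s = Pall K)
    (Fobs : ∀ K, GaugeField (P K) (jl K) SU2 → ℝ) {w l₀ : ℝ} (hw : 0 ≤ w) (hFw : ∀ K U, |Fobs K U| ≤ w)
    (hD0 : ∀ i, 0 ≤ D i)
    (C : ℕ → Finset σ₀)
    (hD : ∀ K, ∀ s ∈ C K, 2 * ((n K s : ℝ) + β K * ∑ _p ∈ Pw K s, (8 * S K) * (8 + 4 * (8 * S K))) / (1 - δ) *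
      Real.exp (2 * l₀ * w) ≤ D 0)
    (uB : ∀ K : ℕ, ℝ → σ₀ → GaugeField (P K) (jl K) SU2 → ℝ)
    (huB : ∀ K t s, Measurable (uB K t s))
    (hclose : ∀ K t, |t| ≤ l₀ → ∀ s ∈ C K,
      ∀ᵐ U ∂((fieldMeasure (P K) (jl K) SU2).withDensity fun U => ENNReal.ofReal (Real.exp (t * Fobs K U)) *
        ENNReal.ofReal (Real.exp (-(β K * ∑ p ∈ Pall K, (1 - reTr (GaugeField.plaqHol U p)))))),
        |wilsonU (hPu K s) U - uB K t s U| ≤ ρ 0 * θ 0) :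
    LevelLedger l₀ (fun K => (C K).powerset)
      (fun K t => regionWeight (C K)
        ((fieldMeasure (P K) (jl K) SU2).withDensity fun U => ENNReal.ofReal (Real.exp (t * Fobs K U)) *
          ENNReal.ofReal (Real.exp (-(β K * ∑ p ∈ Pall K, (1 - reTr (GaugeField.plaqHol U p))))))
        (fun s => wilsonU (hPu K s)) (θ 0))
      (fun K t => regionShell (C K)
        ((fieldMeasure (P K) (jl K) SU2).withDensity fun U => ENNReal.ofReal (Real.exp (t * Fobs K U)) *
          ENNReal.ofReal (Real.exp (-(β K * ∑ p ∈ Pall K, (1 - reTr (GaugeField.plaqHol U p))))))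
        (fun s => wilsonU (hPu K s)) (uB K t) (θ 0))
      C
      (fun K t => regionPiece (C K)
        ((fieldMeasure (P K) (jl K) SU2).withDensity fun U => ENNReal.ofReal (Real.exp (t * Fobs K U)) *
          ENNReal.ofReal (Real.exp (-(β K * ∑ p ∈ Pall K, (1 - reTr (GaugeField.plaqHol U p))))))
        (fun s => wilsonU (hPu K s)) (uB K t) (θ 0))
      (fun _ _ => 0) D ρ := by
  -- every tilted Gibbs law is a finite measure
  haveI : ∀ (K : ℕ) (t : ℝ), IsFiniteMeasure ((fieldMeasure (P K) (jl K) SU2).withDensity fun U =>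
      ENNReal.ofReal (Real.exp (t * Fobs K U)) *
        ENNReal.ofReal (Real.exp (-(β K * ∑ p ∈ Pall K, (1 - reTr (GaugeField.plaqHol U p)))))) := fun K t => by
    refine isFiniteMeasure_withDensity (ne_top_of_le_ne_top ?_ (lintegral_mono (g := fun _ =>
      ENNReal.ofReal (Real.exp (|t| * w))) fun U => ?_))
    · rw [lintegral_const]; exact ENNReal.mul_ne_top ENNReal.ofReal_ne_top (measure_ne_top _ _)
    · calc ENNReal.ofReal (Real.exp (t * Fobs K U)) *
            ENNReal.ofReal (Real.exp (-(β K * ∑ p ∈ Pall K, (1 - reTr (GaugeField.plaqHol U p)))))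
          ≤ ENNReal.ofReal (Real.exp (|t| * w)) * 1 := by
            refine mul_le_mul' (ENNReal.ofReal_le_ofReal (Real.exp_le_exp.2 ?_)) ?_
            · calc t * Fobs K U ≤ |t * Fobs K U| := le_abs_self _
                _ = |t| * |Fobs K U| := abs_mul _ _
                _ ≤ |t| * w := mul_le_mul_of_nonneg_left (hFw K U) (abs_nonneg t)
            · rw [ENNReal.ofReal_le_one, Real.exp_le_one_iff, neg_nonpos]
              exact mul_nonneg (hβ K) (wilsonSum_nonneg (Pall K) U)
        _ = ENNReal.ofReal (Real.exp (|t| * w)) := mul_one _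
  -- (M1)₀ per (K, slot) for `|t| ≤ l₀`, raised to the uniform constant `D 0`
  have hac : ∀ (K : ℕ) (t : ℝ), |t| ≤ l₀ → ∀ s ∈ C K, SlotAntiConcentration
      ((fieldMeasure (P K) (jl K) SU2).withDensity fun U => ENNReal.ofReal (Real.exp (t * Fobs K U)) *
        ENNReal.ofReal (Real.exp (-(β K * ∑ p ∈ Pall K, (1 - reTr (GaugeField.plaqHol U p))))))
      (wilsonU (hPu K s)) (θ 0) (ρ 0) (D 0) := fun K t ht s hs =>
    T4ShellMeasureFibre.slotAntiConcentration_mono (hρ0 0) (hD K s hs)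
      (slotAntiConcentration_wilson_su2_gibbs_source (hN K s) (hm K s) (Λ K s) (hΛbox K s) (hΛcomb K s) (hcov K s)
        (e K s) (hS K) (hS8 K) (hSπ K) (hσ K) (hrad K s) (hPu K s) (hPubox K s) (hboxPu K s) (Pw K s) (Pext K s)
        (Pall K) (hβ K) hθ (hθσ K) hδ0 hδ1 (hρ0 0) hρ (hSM K) (hSMσ K) (hPext K s) (hdisj K s) (hall K s) hw
        (hFw K) ht)
  exact levelLedger_levelZero_cubes
    (μ := fun K t => (fieldMeasure (P K) (jl K) SU2).withDensity fun U => ENNReal.ofReal (Real.exp (t * Fobs K U)) *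
      ENNReal.ofReal (Real.exp (-(β K * ∑ p ∈ Pall K, (1 - reTr (GaugeField.plaqHol U p))))))
    (uA := fun K _ s => wilsonU (hPu K s)) (fun K _ s => measurable_wilsonU (hPu K s)) huB hclose hD0 hρ0 hac

end Summit.QuantumFields.BalabanUV.T4Continuum.ShellMeasureWilsonLedgerFamily

end
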